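import Summits.CriticalPhenomena.PercolationContinuityZ3.Theorems.PercNearOneGluingNoHeavyLowerTailIncStarBridgeConcavityCore
import HarnessLib

/-!
# Bridge concavity of the increasing star — arithmetic core II: the three-point (sub-interval) form

Support file for the Sahi programme (`--supports stmt-CriticalPhenomena-4575`, prover prim-sahi-p2 gen 20).  No definitions, no named
facts, no sorries; pure real arithmetic.  Memo `prim-sahi-p2/PROOF-E3.md` §28m (THEOREM B), §30 (FC); companion of
`…IncStarBridgeConcavityCore` (`IncStar.bridgeConcavity_core`: the bracket `W ≥ 0`) and `…IncStarBridgeEvents` (`bridgeChord_poly`: chord form).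

In the moment parametrisation of THEOREM B (near block: `τ, α, γ, σ, γ+K = gK`; far block: `σ′, m_b, m_c, m_bc, d_b, d_c, d_bc, ξ_b, ξ_c,
y_b, y_c`; `m1 = P¹(ABC)`), Sahi's cubic along the bridge is
`f(q) = 2(τ m_bc + q(m1 − τ m_bc)) + (τ + qδ_a)(m_b + qδ_b)(m_c + qδ_c) − [(τ + qδ_a)(m_bc + qδ_bc) + (m_b + qδ_b)(τ m_c + qδ_ac) + (m_c + qδ_c)(τ m_b + qδ_ab)]`
with `δ_a = ασ′`, `δ_b = σd_b`, `δ_c = σd_c`, `δ_ab = gK d_b + αy_b`, `δ_ac = gK d_c + αy_c`, `δ_bc = σ(ξ_b + ξ_c + d_bc)`.  Its second derivative is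
`−f″(q)/2 = (1 − q)V₀ + qV₁`, `V₁ = σW`, `V₀ = V₁ + 3δ_aδ_bδ_c`, `W` the bracket of `IncStar.bridgeConcavity_core`; hence the THREE-POINT identity
(`bridgeCubic_threePoint`, by `ring`)
`(p₁ − p₀)f(p) − [(p₁ − p)f(p₀) + (p − p₀)f(p₁)] = (p − p₀)(p₁ − p)(p₁ − p₀)[V₀(3 − (p₀+p+p₁)) + V₁(p₀+p+p₁)]/3`
and (`bridgeCubic_concave_real`) the cubic is CONCAVE on `[0,1]` in three-point form under the four classical inequalities (H1)–(H4) —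
the sub-interval form of THEOREM B used by the blob reparametrisations of FC (`…IncStarRootPairTransfer`).
-/

namespace Summit.CriticalPhenomena.PercolationContinuityZ3.Theorems

namespace IncStar

/-- **Three-point identity for the bridge cubic.** [this work] -/
theorem bridgeCubic_threePoint (p₀ p p₁ τ mb mc mbc m1 α σ gK σ' db dc dbc ξb ξc yb yc : ℝ) :
    (p₁ - p₀) * (2 * (τ * mbc + p * (m1 - τ * mbc))
        + (τ + p * (α * σ')) * (mb + p * (σ * db)) * (mc + p * (σ * dc))
        - ((τ + p * (α * σ')) * (mbc + p * (σ * (ξb + ξc + dbc)))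
            + (mb + p * (σ * db)) * (τ * mc + p * (gK * dc + α * yc))
            + (mc + p * (σ * dc)) * (τ * mb + p * (gK * db + α * yb))))
      - ((p₁ - p) * (2 * (τ * mbc + p₀ * (m1 - τ * mbc))
        + (τ + p₀ * (α * σ')) * (mb + p₀ * (σ * db)) * (mc + p₀ * (σ * dc))
        - ((τ + p₀ * (α * σ')) * (mbc + p₀ * (σ * (ξb + ξc + dbc)))
            + (mb + p₀ * (σ * db)) * (τ * mc + p₀ * (gK * dc + α * yc))
            + (mc + p₀ * (σ * dc)) * (τ * mb + p₀ * (gK * db + α * yb))))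
        + (p - p₀) * (2 * (τ * mbc + p₁ * (m1 - τ * mbc))
        + (τ + p₁ * (α * σ')) * (mb + p₁ * (σ * db)) * (mc + p₁ * (σ * dc))
        - ((τ + p₁ * (α * σ')) * (mbc + p₁ * (σ * (ξb + ξc + dbc)))
            + (mb + p₁ * (σ * db)) * (τ * mc + p₁ * (gK * dc + α * yc))
            + (mc + p₁ * (σ * dc)) * (τ * mb + p₁ * (gK * db + α * yb)))))
    = (p - p₀) * (p₁ - p) * (p₁ - p₀)
        * (((σ * (α * σ' * (ξb + ξc + dbc) - α * σ' * (mb * dc + mc * db) + 2 * gK * db * dc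
        - τ * σ * db * dc - 3 * α * σ' * σ * db * dc + α * (db * yc + dc * yb))) + 3 * ((α * σ') * (db * σ) * (dc * σ))) * (3 - (p₀ + p + p₁))
          + (σ * (α * σ' * (ξb + ξc + dbc) - α * σ' * (mb * dc + mc * db) + 2 * gK * db * dc
        - τ * σ * db * dc - 3 * α * σ' * σ * db * dc + α * (db * yc + dc * yb))) * (p₀ + p + p₁)) / 3 := by
  ring

/-- **Concavity of the bridge cubic on `[0,1]` (three-point form)**, from the sign conditions and the four classical inequalities
(H1) Harris on the far side, (H2), (H4) Harris on the near side, (H3) van den Berg–Kahn. [this work] -/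
theorem bridgeCubic_concave_real (p₀ p p₁ τ mb mc mbc m1 α γ σ gK σ' db dc dbc ξb ξc yb yc : ℝ)
    (h0 : 0 ≤ p₀) (h01 : p₀ ≤ p) (h12 : p ≤ p₁) (h1 : p₁ ≤ 1)
    (hα : 0 ≤ α) (hγ : 0 ≤ γ) (hσ : 0 ≤ σ) (hσ'0 : 0 ≤ σ') (hσ'1 : σ' ≤ 1) (hK : γ ≤ gK)
    (hdb : 0 ≤ db) (hdc : 0 ≤ dc) (hξb : 0 ≤ ξb) (hξc : 0 ≤ ξc)
    (H1b : σ' * mb ≤ yb) (H1c : σ' * mc ≤ yc) (H2 : τ * σ ≤ gK) (H3 : db * dc ≤ dbc) (H4 : σ * (α + γ) ≤ γ) :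
    (p₁ - p) * (2 * (τ * mbc + p₀ * (m1 - τ * mbc))
        + (τ + p₀ * (α * σ')) * (mb + p₀ * (σ * db)) * (mc + p₀ * (σ * dc))
        - ((τ + p₀ * (α * σ')) * (mbc + p₀ * (σ * (ξb + ξc + dbc)))
            + (mb + p₀ * (σ * db)) * (τ * mc + p₀ * (gK * dc + α * yc))
            + (mc + p₀ * (σ * dc)) * (τ * mb + p₀ * (gK * db + α * yb))))
      + (p - p₀) * (2 * (τ * mbc + p₁ * (m1 - τ * mbc))
        + (τ + p₁ * (α * σ')) * (mb + p₁ * (σ * db)) * (mc + p₁ * (σ * dc))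
        - ((τ + p₁ * (α * σ')) * (mbc + p₁ * (σ * (ξb + ξc + dbc)))
            + (mb + p₁ * (σ * db)) * (τ * mc + p₁ * (gK * dc + α * yc))
            + (mc + p₁ * (σ * dc)) * (τ * mb + p₁ * (gK * db + α * yb))))
    ≤ (p₁ - p₀) * (2 * (τ * mbc + p * (m1 - τ * mbc))
        + (τ + p * (α * σ')) * (mb + p * (σ * db)) * (mc + p * (σ * dc))
        - ((τ + p * (α * σ')) * (mbc + p * (σ * (ξb + ξc + dbc)))
            + (mb + p * (σ * db)) * (τ * mc + p * (gK * dc + α * yc))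
            + (mc + p * (σ * dc)) * (τ * mb + p * (gK * db + α * yb)))) := by
  have hW := bridgeConcavity_core α γ σ τ (gK - γ) σ' db dc dbc ξb ξc yb yc mb mc hα hγ hσ'0 hσ'1 (by linarith)
    hdb hdc hξb hξc H1b H1c (by linarith) H3 H4
  have hW' : 0 ≤ (α * σ' * (ξb + ξc + dbc) - α * σ' * (mb * dc + mc * db) + 2 * gK * db * dc
        - τ * σ * db * dc - 3 * α * σ' * σ * db * dc + α * (db * yc + dc * yb)) := by
    have hid : (α * σ' * (ξb + ξc + dbc) - α * σ' * (mb * dc + mc * db) + 2 * gK * db * dc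
        - τ * σ * db * dc - 3 * α * σ' * σ * db * dc + α * (db * yc + dc * yb))
        = α * σ' * (ξb + ξc + dbc) - α * σ' * (mb * dc + mc * db) + 2 * (γ + (gK - γ)) * db * dc
          - τ * σ * db * dc - 3 * α * σ' * σ * db * dc + α * (db * yc + dc * yb) := by ring
    rw [hid]
    exact hW
  have hV1 : 0 ≤ (σ * (α * σ' * (ξb + ξc + dbc) - α * σ' * (mb * dc + mc * db) + 2 * gK * db * dc
        - τ * σ * db * dc - 3 * α * σ' * σ * db * dc + α * (db * yc + dc * yb))) := mul_nonneg hσ hW'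
  have hD3 : 0 ≤ 3 * ((α * σ') * (db * σ) * (dc * σ)) :=
    mul_nonneg (by norm_num) (mul_nonneg (mul_nonneg (mul_nonneg hα hσ'0) (mul_nonneg hdb hσ)) (mul_nonneg hdc hσ))
  have hV0 : 0 ≤ ((σ * (α * σ' * (ξb + ξc + dbc) - α * σ' * (mb * dc + mc * db) + 2 * gK * db * dc
        - τ * σ * db * dc - 3 * α * σ' * σ * db * dc + α * (db * yc + dc * yb))) + 3 * ((α * σ') * (db * σ) * (dc * σ))) := add_nonneg hV1 hD3
  have hbr : 0 ≤ ((σ * (α * σ' * (ξb + ξc + dbc) - α * σ' * (mb * dc + mc * db) + 2 * gK * db * dc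
        - τ * σ * db * dc - 3 * α * σ' * σ * db * dc + α * (db * yc + dc * yb))) + 3 * ((α * σ') * (db * σ) * (dc * σ))) * (3 - (p₀ + p + p₁))
          + (σ * (α * σ' * (ξb + ξc + dbc) - α * σ' * (mb * dc + mc * db) + 2 * gK * db * dc
        - τ * σ * db * dc - 3 * α * σ' * σ * db * dc + α * (db * yc + dc * yb))) * (p₀ + p + p₁) :=
    add_nonneg (mul_nonneg hV0 (by linarith)) (mul_nonneg hV1 (by linarith))
  have hprod : 0 ≤ (p - p₀) * (p₁ - p) * (p₁ - p₀) :=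
    mul_nonneg (mul_nonneg (sub_nonneg.2 h01) (sub_nonneg.2 h12)) (by linarith)
  have key := bridgeCubic_threePoint p₀ p p₁ τ mb mc mbc m1 α σ gK σ' db dc dbc ξb ξc yb yc
  have hrhs : 0 ≤ (p - p₀) * (p₁ - p) * (p₁ - p₀)
        * (((σ * (α * σ' * (ξb + ξc + dbc) - α * σ' * (mb * dc + mc * db) + 2 * gK * db * dc
        - τ * σ * db * dc - 3 * α * σ' * σ * db * dc + α * (db * yc + dc * yb))) + 3 * ((α * σ') * (db * σ) * (dc * σ))) * (3 - (p₀ + p + p₁))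
          + (σ * (α * σ' * (ξb + ξc + dbc) - α * σ' * (mb * dc + mc * db) + 2 * gK * db * dc
        - τ * σ * db * dc - 3 * α * σ' * σ * db * dc + α * (db * yc + dc * yb))) * (p₀ + p + p₁)) / 3 :=
    div_nonneg (mul_nonneg hprod hbr) (by norm_num)
  linarith [key, hrhs]

end IncStar

end Summit.CriticalPhenomena.PercolationContinuityZ3.Theorems
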